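import Literature.MathematicalPhysics.QuantumFieldTheory.OSPointGlobalDensity
import Literature.MathematicalPhysics.QuantumFieldTheory.OSPointLabelledVectors
import Literature.MathematicalPhysics.QuantumFieldTheory.OSTimeContinuation
import HarnessLib

/-!
# Packaging a labelled time continuation into the form of OS II Theorem 4.3 (H21's (A1))

Topic `Literature/MathematicalPhysics/QuantumFieldTheory`; support file (all proved; the packaging
maps as definitions; no named facts) for the discharge of (A1) `OS1975_exists_timeContinuation`.
Osterwalder–Schrader II (Comm. Math. Phys. 42 (1975)), §IV.2 Thm. 4.3: "there are functions
`S_k(ζ⁰ | ξ⃗)`, analytic in `ζ⁰`, continuous in `ξ⃗`, such that (4.4) and (4.6) hold". Given a family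
`Sx c ζ` of functions of the complex time gaps `ζ ∈ ℂ₊^{k+1}` labelled by the spatial positions
`c` of `k + 2` points — holomorphic in `ζ`, jointly continuous, invariant under a common translation
of the labels, polynomially bounded, and equal at the positive real gaps to a tempered continuous
local density `D` of `𝔖 (k+2)` at the corresponding configuration — the function
`𝔚(z) = Sx (x⃗(z)) (−i Δz⁰)` of H21's complex point variables has all the properties of (A1) for
`n = k + 2`: continuity on the time tube, holomorphy in the times, invariance under real
translations, OS growth, and the Euclidean restriction (4.4) on all time-ordered test functions
(`OSPointGlobalDensity.IsLocalDensity.integral_eq`).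

* `spLabels`, `cGaps`, `packW` — the packaging maps;
* `timeContinuation_of_labelled` — the statement above.

## References

* K. Osterwalder, R. Schrader, *Axioms for Euclidean Green's functions II*, Comm. Math. Phys.
  42 (1975) 281–305, §IV.2 Thm. 4.3, (4.4), (4.6). [OsterwalderSchraderCMP1975]
-/

noncomputable section

open MeasureTheory Set Filter Metric Function Complex
open _root_.Topology
open scoped SchwartzMap

namespace Literature.MathematicalPhysics.QuantumFieldTheory

variable {d : ℕ} {k : ℕ}

open Literature.MathematicalPhysics.QuantumLattice (SchwingerFamily SpaceTime complexifyPoint complexifyPoint_apply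
  euclideanPoint euclideanPoint_apply_zero euclideanPoint_apply_succ succDiff succDiff_zero succDiff_succ IsTimeOrdered)
open Literature.MathematicalPhysics.QuantumLattice.SchwingerFamily

/-! ### The packaging maps -/

/-- **The spatial label of a complex point**: its real spatial part, with time coordinate `0`. [folklore] -/
def spLabel (w : Fin (d + 1) → ℂ) : SpaceTime d := WithLp.toLp 2 fun μ => if μ = 0 then 0 else (w μ).re

/-- Coordinates of the spatial label. [folklore] -/
@[simp] theorem spLabel_apply (w : Fin (d + 1) → ℂ) (μ : Fin (d + 1)) :
    spLabel w μ = if μ = 0 then 0 else (w μ).re := rfl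

/-- **The spatial labels** of a complex configuration. [folklore] -/
def spLabels {n : ℕ} (z : Fin n → Fin (d + 1) → ℂ) : Fin n → SpaceTime d := fun j => spLabel (z j)

/-- **The complex time gaps** `ζᵢ = −i (z⁰_{i+1} − z⁰ᵢ)`. [cite: OsterwalderSchraderCMP1975, §IV.2 p. 289 ("iζ⁰ are actually the times")] -/
def cGaps (z : Fin (k + 2) → Fin (d + 1) → ℂ) : Fin (k + 1) → ℂ :=
  fun i => -I * (z i.succ 0 - z (Fin.castSucc i) 0)

/-- **The packaged function** `𝔚(z) = Sx (x⃗(z)) (ζ(z))`. [cite: OsterwalderSchraderCMP1975, §IV.2 Thm. 4.3] -/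
def packW (Sx : (Fin (k + 2) → SpaceTime d) → (Fin (k + 1) → ℂ) → ℂ) (z : Fin (k + 2) → Fin (d + 1) → ℂ) : ℂ :=
  Sx (spLabels z) (cGaps z)

/-! ### Elementary properties of the maps -/

/-- Real parts of the gaps are the imaginary parts of the time differences. [folklore] -/
@[simp] theorem cGaps_re (z : Fin (k + 2) → Fin (d + 1) → ℂ) (i : Fin (k + 1)) :
    (cGaps z i).re = (z i.succ 0 - z (Fin.castSucc i) 0).im := by
  simp [cGaps]

/-- On the time tube the gaps have positive real parts. [folklore] -/
theorem cGaps_re_pos {z : Fin (k + 2) → Fin (d + 1) → ℂ} (hz : z ∈ timeTube d (k + 2)) (i : Fin (k + 1)) :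
    0 < (cGaps z i).re := by
  rw [cGaps_re]
  have h := hz.2 i.succ
  rwa [succDiff_succ] at h

/-- Continuity of the spatial labels. [folklore] -/
theorem continuous_spLabels {n : ℕ} : Continuous (spLabels (d := d) (n := n)) := by
  refine continuous_pi fun j => ?_
  simp only [spLabels, spLabel]
  refine (PiLp.continuous_toLp 2 _).comp (continuous_pi fun μ => ?_)
  by_cases hμ : μ = 0
  · simp only [hμ, if_true]; exact continuous_const
  · simp only [hμ, if_false]
    exact Complex.continuous_re.comp ((continuous_apply μ).comp (continuous_apply j))

/-- Continuity of the gaps. [folklore] -/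
theorem continuous_cGaps : Continuous (cGaps (d := d) (k := k)) := by
  have h : ∀ j : Fin (k + 2), Continuous fun z : Fin (k + 2) → Fin (d + 1) → ℂ => z j 0 := fun j =>
    (continuous_apply 0).comp (continuous_apply j)
  exact continuous_pi fun i => continuous_const.mul ((h i.succ).sub (h (Fin.castSucc i)))

/-- The gaps of `withTimes z w` depend holomorphically on `w`. [folklore] -/
theorem cGaps_withTimes (z : Fin (k + 2) → Fin (d + 1) → ℂ) (w : Fin (k + 2) → ℂ) :
    cGaps (withTimes z w) = fun i => -I * (w i.succ - w (Fin.castSucc i)) := by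
  funext i; simp [cGaps]

/-- The spatial labels of `withTimes z w` are those of `z`. [folklore] -/
theorem spLabels_withTimes (z : Fin (k + 2) → Fin (d + 1) → ℂ) (w : Fin (k + 2) → ℂ) :
    spLabels (withTimes z w) = spLabels z := by
  funext j; ext μ
  by_cases hμ : μ = 0
  · simp [spLabels, hμ]
  · simp [spLabels, hμ, withTimes]

/-- Holomorphy of `w ↦ ζ(withTimes z w)`. [folklore] -/
theorem differentiable_cGaps_withTimes (z : Fin (k + 2) → Fin (d + 1) → ℂ) :
    Differentiable ℂ fun w : Fin (k + 2) → ℂ => cGaps (withTimes z w) := by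
  simp only [cGaps_withTimes]
  exact differentiable_pi.2 fun i =>
    (differentiable_const _).mul ((differentiable_apply i.succ).sub (differentiable_apply (Fin.castSucc i)))

/-- Real translations shift the spatial labels by the spatial part and leave the gaps unchanged. [folklore] -/
theorem spLabels_add_complexifyPoint (z : Fin (k + 2) → Fin (d + 1) → ℂ) (a : SpaceTime d) :
    spLabels (fun j => z j + complexifyPoint a) = fun j => spLabels z j + spLabel (complexifyPoint a) := by
  funext j; ext μ
  by_cases hμ : μ = 0
  · simp [spLabels, hμ]
  · simp [spLabels, hμ, complexifyPoint_apply]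

/-- Real translations leave the gaps unchanged. [folklore] -/
theorem cGaps_add_complexifyPoint (z : Fin (k + 2) → Fin (d + 1) → ℂ) (a : SpaceTime d) :
    cGaps (fun j => z j + complexifyPoint a) = cGaps z := by
  funext i; simp [cGaps, complexifyPoint_apply]

/-- At Euclidean points the gaps are the real time gaps. [folklore] -/
theorem cGaps_euclideanPoint (x : Fin (k + 2) → SpaceTime d) :
    cGaps (euclideanPoint x) = fun i => ((gapsOf x i : ℝ) : ℂ) := by
  funext i
  simp only [cGaps, euclideanPoint_apply_zero, gapsOf]
  push_cast
  ring_nf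
  simp [Complex.I_sq]
  ring

/-- At Euclidean points the spatial labels are the points with time coordinate zeroed. [folklore] -/
theorem spLabels_euclideanPoint (x : Fin (k + 2) → SpaceTime d) :
    spLabels (euclideanPoint x) = fun j => x j + timeVec (-(x j 0)) := by
  funext j; ext μ
  by_cases hμ : μ = 0
  · subst hμ; simp [spLabels]
  · obtain ⟨i, rfl⟩ := Fin.exists_succ_eq.2 hμ
    simp [spLabels, Fin.succ_ne_zero]

/-- Telescoping: `x⁰₀ + ∑_{i<j} gapsOf x i = x⁰ⱼ`. [folklore] -/
theorem partialSum_gapsOf (x : Fin (k + 2) → SpaceTime d) (j : Fin (k + 2)) :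
    x 0 0 + Fin.partialSum (gapsOf x) j = x j 0 := by
  induction j using Fin.induction with
  | zero => simp
  | succ i ih =>
    rw [Fin.partialSum_succ, ← add_assoc, ih]
    simp [gapsOf]

/-- The labelled configuration of the Euclidean labels with the real gaps is `x` translated to
initial time `0`. [folklore] -/
theorem labCfg_spLabels_euclideanPoint (x : Fin (k + 2) → SpaceTime d) :
    labCfg (spLabels (euclideanPoint x)) 0 (gapsOf x) = fun j => x j + timeVec (-(x 0 0)) := by
  rw [spLabels_euclideanPoint, labCfg_add_timeVec_labels]
  funext j
  simp only [labCfg, zero_add]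
  congr 1
  have h := partialSum_gapsOf x j
  rw [show Fin.partialSum (gapsOf x) j - x j 0 = -(x 0 0) by linarith]

/-! ### Norm comparisons for the growth -/

/-- `‖spLabel w‖ ≤ (d + 1) ‖w‖`. [folklore] -/
theorem norm_spLabel_le (w : Fin (d + 1) → ℂ) : ‖spLabel w‖ ≤ (d + 1) * ‖w‖ := by
  have hco : ∀ μ, ‖spLabel w μ‖ ≤ ‖w‖ := fun μ => by
    rw [spLabel_apply]
    split_ifs
    · simp
    · rw [Real.norm_eq_abs]; exact (Complex.abs_re_le_norm _).trans (norm_le_pi_norm w μ)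
  rw [EuclideanSpace.norm_eq]
  have hsum : ∑ μ, ‖spLabel w μ‖ ^ 2 ≤ ((d + 1 : ℕ) : ℝ) * ‖w‖ ^ 2 := by
    calc ∑ μ, ‖spLabel w μ‖ ^ 2 ≤ ∑ _μ : Fin (d + 1), ‖w‖ ^ 2 :=
          Finset.sum_le_sum fun μ _ => pow_le_pow_left₀ (norm_nonneg _) (hco μ) 2
      _ = ((d + 1 : ℕ) : ℝ) * ‖w‖ ^ 2 := by simp
  calc Real.sqrt (∑ μ, ‖spLabel w μ‖ ^ 2) ≤ Real.sqrt (((d + 1 : ℕ) : ℝ) * ‖w‖ ^ 2) := Real.sqrt_le_sqrt hsum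
    _ = Real.sqrt ((d + 1 : ℕ) : ℝ) * ‖w‖ := by rw [Real.sqrt_mul (by positivity), Real.sqrt_sq (norm_nonneg _)]
    _ ≤ (d + 1) * ‖w‖ := by
        refine mul_le_mul_of_nonneg_right ?_ (norm_nonneg _)
        have h1 : (1 : ℝ) ≤ ((d + 1 : ℕ) : ℝ) := by exact_mod_cast Nat.succ_le_succ (Nat.zero_le d)
        rw [Real.sqrt_le_left (by positivity)]
        push_cast
        nlinarith

/-- `‖spLabels z‖ ≤ (d + 1) ‖z‖`. [folklore] -/
theorem norm_spLabels_le {n : ℕ} (z : Fin n → Fin (d + 1) → ℂ) : ‖spLabels z‖ ≤ (d + 1) * ‖z‖ := by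
  refine (pi_norm_le_iff_of_nonneg (by positivity)).2 fun j => ?_
  exact (norm_spLabel_le (z j)).trans (mul_le_mul_of_nonneg_left (norm_le_pi_norm z j) (by positivity))

/-- The gaps are bounded by twice the size of the configuration. [folklore] -/
theorem norm_cGaps_apply_le (z : Fin (k + 2) → Fin (d + 1) → ℂ) (i : Fin (k + 1)) : ‖cGaps z i‖ ≤ 2 * ‖z‖ := by
  rw [cGaps, norm_mul, norm_neg, Complex.norm_I, one_mul]
  calc ‖z i.succ 0 - z (Fin.castSucc i) 0‖ ≤ ‖z i.succ 0‖ + ‖z (Fin.castSucc i) 0‖ := norm_sub_le _ _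
    _ ≤ ‖z‖ + ‖z‖ := add_le_add ((norm_le_pi_norm (z i.succ) 0).trans (norm_le_pi_norm z _))
        ((norm_le_pi_norm (z (Fin.castSucc i)) 0).trans (norm_le_pi_norm z _))
    _ = 2 * ‖z‖ := by ring

/-- On the time tube, the sum of the inverse real parts of the gaps is at most the sum over all
inverse imaginary time differences of H21's `HasOSGrowth`. [folklore] -/
theorem sum_inv_cGaps_re_le {z : Fin (k + 2) → Fin (d + 1) → ℂ} (hz : z ∈ timeTube d (k + 2)) :
    ∑ i, ((cGaps z i).re)⁻¹ ≤ ∑ j, ((succDiff (fun j => z j 0) j).im)⁻¹ := by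
  rw [Fin.sum_univ_succ (f := fun j => ((succDiff (fun j => z j 0) j).im)⁻¹)]
  have h0 : 0 ≤ ((succDiff (fun j => z j 0) 0).im)⁻¹ := (inv_pos.2 (hz.2 0)).le
  have h1 : ∑ i, ((cGaps z i).re)⁻¹ = ∑ i : Fin (k + 1), ((succDiff (fun j => z j 0) i.succ).im)⁻¹ :=
    Finset.sum_congr rfl fun i _ => by rw [cGaps_re, succDiff_succ]
  linarith

/-! ### The packaging theorem -/

/-- `1 + a x ≤ (1 + a)(1 + x)` for `a, x ≥ 0`. [folklore] -/
theorem one_add_mul_le {a x : ℝ} (ha : 0 ≤ a) (hx : 0 ≤ x) : 1 + a * x ≤ (1 + a) * (1 + x) := by nlinarith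

/-- **Packaging a labelled time continuation into H21's (A1) shape** (OS II Thm. 4.3 from Thm. 4.2
with (4.4) and (4.6)), for `n = k + 2 ≥ 2` points: see the module docstring. [cite: OsterwalderSchraderCMP1975, §IV.2 Thm. 4.3, (4.4), (4.6)] -/
theorem timeContinuation_of_labelled {S : SchwingerFamily (SpaceTime d)} (hE1 : S.IsEuclideanCovariant)
    {Sx : (Fin (k + 2) → SpaceTime d) → (Fin (k + 1) → ℂ) → ℂ}
    (h1 : ∀ c, DifferentiableOn ℂ (Sx c) {ζ | ∀ i, 0 < (ζ i).re})
    (h2 : ContinuousOn (fun q : (Fin (k + 2) → SpaceTime d) × (Fin (k + 1) → ℂ) => Sx q.1 q.2)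
      (univ ×ˢ {ζ | ∀ i, 0 < (ζ i).re}))
    (h3 : ∀ (c : Fin (k + 2) → SpaceTime d) (a : SpaceTime d) (ζ : Fin (k + 1) → ℂ), (∀ i, 0 < (ζ i).re) →
      Sx (fun j => c j + a) ζ = Sx c ζ)
    (h4 : ∃ (C : ℝ) (N : ℕ), 0 ≤ C ∧ ∀ (c : Fin (k + 2) → SpaceTime d) (ζ : Fin (k + 1) → ℂ), (∀ i, 0 < (ζ i).re) →
      ‖Sx c ζ‖ ≤ C * (1 + ‖c‖) ^ N * (1 + ∑ i, ‖ζ i‖) ^ N * (1 + ∑ i, ((ζ i).re)⁻¹) ^ N)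
    {D : (Fin (k + 2) → SpaceTime d) → ℂ} (hD : IsLocalDensity S (k + 2) D)
    (hDb : ∃ (C : ℝ) (N₀ : ℕ), ∀ x ∈ incrTimes (k + 2) (d + 1), ‖D x‖ ≤ C * (1 + ‖x‖) ^ N₀ * (1 + (minGap x)⁻¹) ^ N₀)
    (h5 : ∀ (c : Fin (k + 2) → SpaceTime d) (ρ : Fin (k + 1) → ℝ), (∀ i, 0 < ρ i) →
      Sx c (fun i => (ρ i : ℂ)) = D (labCfg c 0 ρ)) :
    ContinuousOn (packW Sx) (timeTube d (k + 2)) ∧ IsTimeHolomorphicOn (packW Sx) (timeTube d (k + 2)) ∧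
      (∀ z ∈ timeTube d (k + 2), ∀ a : SpaceTime d, packW Sx (fun j => z j + complexifyPoint a) = packW Sx z) ∧
      HasOSGrowth (packW Sx) ∧
      ∀ F : 𝓢((Fin (k + 2) → SpaceTime d), ℂ), IsTimeOrdered F →
        S (k + 2) F = ∫ x : Fin (k + 2) → SpaceTime d, packW Sx (euclideanPoint x) * F x := by
  refine ⟨?_, ?_, ?_, ?_, ?_⟩
  · -- continuity on the time tube
    exact h2.comp (continuous_spLabels.prodMk continuous_cGaps).continuousOn fun z hz => ⟨mem_univ _, cGaps_re_pos hz⟩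
  · -- holomorphy in the times
    intro z _
    show DifferentiableOn ℂ (fun w => Sx (spLabels (withTimes z w)) (cGaps (withTimes z w))) {w | withTimes z w ∈ timeTube d (k + 2)}
    simp only [spLabels_withTimes]
    exact (h1 _).comp (differentiable_cGaps_withTimes z).differentiableOn fun w hw i => cGaps_re_pos hw i
  · -- invariance under real translations
    intro z hz a
    show Sx (spLabels fun j => z j + complexifyPoint a) (cGaps fun j => z j + complexifyPoint a) = Sx (spLabels z) (cGaps z)
    rw [spLabels_add_complexifyPoint, cGaps_add_complexifyPoint]
    exact h3 _ _ _ (cGaps_re_pos hz)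
  · -- OS growth
    obtain ⟨C, N, hC, hb⟩ := h4
    refine ⟨C * (((d : ℝ) + 2) * (2 * (k : ℝ) + 3)) ^ N, N + N, fun z hz => ?_⟩
    have hζ := cGaps_re_pos hz
    have h := hb (spLabels z) (cGaps z) hζ
    set T : ℝ := ∑ j, ((succDiff (fun j => z j 0) j).im)⁻¹ with hT
    have hT0 : 0 ≤ T := Finset.sum_nonneg fun j _ => (inv_pos.2 (hz.2 j)).le
    have hz0 : 0 ≤ ‖z‖ := norm_nonneg _
    -- the three factors
    have hA : 1 + ‖spLabels z‖ ≤ ((d : ℝ) + 2) * (1 + ‖z‖) := by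
      have h1 := norm_spLabels_le z
      have h2 := one_add_mul_le (a := (d : ℝ) + 1) (by positivity) hz0
      linarith
    have hB : 1 + ∑ i, ‖cGaps z i‖ ≤ (2 * (k : ℝ) + 3) * (1 + ‖z‖) := by
      have h1 : ∑ i, ‖cGaps z i‖ ≤ ∑ _i : Fin (k + 1), 2 * ‖z‖ := Finset.sum_le_sum fun i _ => norm_cGaps_apply_le z i
      rw [Finset.sum_const, Finset.card_univ, Fintype.card_fin, nsmul_eq_mul] at h1
      have h2 := one_add_mul_le (a := 2 * ((k : ℝ) + 1)) (by positivity) hz0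
      push_cast at h1
      linarith
    have hCc : 1 + ∑ i, ((cGaps z i).re)⁻¹ ≤ 1 + T := by linarith [sum_inv_cGaps_re_le hz]
    have hS0 : 0 ≤ 1 + ∑ i, ((cGaps z i).re)⁻¹ := by
      have : 0 ≤ ∑ i, ((cGaps z i).re)⁻¹ := Finset.sum_nonneg fun i _ => (inv_pos.2 (hζ i)).le
      linarith
    calc ‖packW Sx z‖ = ‖Sx (spLabels z) (cGaps z)‖ := rfl
      _ ≤ C * (1 + ‖spLabels z‖) ^ N * (1 + ∑ i, ‖cGaps z i‖) ^ N * (1 + ∑ i, ((cGaps z i).re)⁻¹) ^ N := h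
      _ ≤ C * (((d : ℝ) + 2) * (1 + ‖z‖)) ^ N * ((2 * (k : ℝ) + 3) * (1 + ‖z‖)) ^ N * (1 + T) ^ N := by
          gcongr
      _ = C * (((d : ℝ) + 2) * (2 * (k : ℝ) + 3)) ^ N * (1 + ‖z‖) ^ (N + N) * (1 + T) ^ N := by
          rw [mul_pow, mul_pow, mul_pow, pow_add]; ring
      _ ≤ C * (((d : ℝ) + 2) * (2 * (k : ℝ) + 3)) ^ N * (1 + ‖z‖) ^ (N + N) * (1 + T) ^ (N + N) := by
          refine mul_le_mul_of_nonneg_left (pow_le_pow_right₀ (by linarith) (Nat.le_add_right N N)) (by positivity)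
  · -- the Euclidean restriction (4.4) on all time-ordered test functions
    intro F hF
    have hF' : tsupport (F : (Fin (k + 2) → SpaceTime d) → ℂ) ⊆ incrTimes (k + 2) (d + 1) := fun x hx => (hF hx).2
    obtain ⟨-, hrep⟩ := hD.integral_eq hDb F hF'
    rw [hrep]
    refine integral_congr_ae (Eventually.of_forall fun x => ?_)
    show D x * F x = packW Sx (euclideanPoint x) * F x
    by_cases hx : x ∈ tsupport (F : (Fin (k + 2) → SpaceTime d) → ℂ)
    · have hxI : x ∈ incrTimes (k + 2) (d + 1) := hF' hx
      have hgap : ∀ i, 0 < gapsOf x i := fun i => sub_pos.2 (hxI (Fin.castSucc_lt_succ (i := i)))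
      congr 1
      rw [packW, cGaps_euclideanPoint, h5 _ _ hgap, labCfg_spLabels_euclideanPoint]
      exact (hD.add_timeVec hE1 _ hxI).symm
    · rw [image_eq_zero_of_notMem_tsupport hx, mul_zero, mul_zero]

end Literature.MathematicalPhysics.QuantumFieldTheory
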